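import Summits.QuantumAdvantage.QuantumAdvantage.Theorems.MobiusLadderLiouvilleOrthogonalTC0SpectralLevel
import Mathlib.Logic.Function.DependsOn
import HarnessLib

/-!
# Crux `MobiusLadder.LiouvilleOrthogonalTC0` (stmt-QuantumAdvantage-1393): the junta rung — `λ` is
orthogonal to every function of at most `n^α` of the binary digits, unconditionally

Line `Sketch` (lead `prover-line-stmt-QuantumAdvantage-1393-c2-0`). The simplest instance of the
single-level spectral criterion (`liouville_orthogonal_of_tailWeight_level`): a Boolean function that
depends only on a set `J` of coordinates has NO Fourier weight above level `|J|` (`tailWeight_junta_eq_zero`),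
so if `|J| ≤ n^{1/R}` (`R = ⌈3/c⌉₊`, `c` = Bourgain's exponent) its tail above the criterion's level
`⌊n^{1/R}⌋₊ + 1` vanishes.

* `cubeFourierCoeff_eq_zero_of_dependsOn` — `F̂(S) = 0` whenever `F` depends only on `J` and `S ⊄ J`;
* `tailWeight_junta_eq_zero` — `W^{≥ |J|+1}[F] = 0` for such `F`;
* `liouville_orthogonal_junta` — there is `α > 0` such that for every `ε > 0`, eventually in `n`, every
  `F : {0,1}ⁿ → {0,1}` depending on at most `n^α` digit positions (ANY positions — low, high or mixed —
  and ANY function of them) has `|Σ_{N<2ⁿ} λ(N) sgn F(bits N)| ≤ ε 2ⁿ` (registered stub `stub_junta`).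

Classically the low digits (periodicity, `λ` in progressions) and the high digits (`λ` in short
intervals) are handled by different tools; Bourgain's uniform Walsh bound treats any `n^α` digits at once.
-/

set_option linter.dupNamespace false -- D-0017: single-problem summit ⇒ `QuantumAdvantage.QuantumAdvantage` by design

noncomputable section

namespace Summit.QuantumAdvantage.QuantumAdvantage.Theorems.LiouvilleOrthogonalTC0

open Filter Finset Topology
open Literature.Computability.Complexity
open Literature.Computability.Complexity.LowDegree (tailWeight cubeFourierCoeff tailWeight_antitone)
open Literature.Probability.RandomGraphs.LowDegree (sgn walsh)
open Literature.NumberTheory.Sieve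

namespace Junta

variable {n : ℕ}

/-- Flipping coordinate `i` flips the sign of every character containing `i`. -/
theorem walsh_update_not {S : Finset (Fin n)} {i : Fin n} (hi : i ∈ S) (x : Fin n → Bool) :
    walsh S (Function.update x i (!x i)) = -walsh S x := by
  unfold walsh
  rw [← Finset.mul_prod_erase S _ hi, ← Finset.mul_prod_erase S (fun j => sgn (x j)) hi]
  have h1 : ∏ j ∈ S.erase i, sgn (Function.update x i (!x i) j) = ∏ j ∈ S.erase i, sgn (x j) := by
    refine Finset.prod_congr rfl fun j hj => ?_
    rw [Function.update_of_ne (Finset.ne_of_mem_erase hj)]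
  rw [h1, Function.update_self]
  cases x i <;> simp [sgn]

/-- **A junta has no Fourier coefficient outside its support**: if `F` depends only on the
coordinates in `J` and `S ⊄ J`, then `F̂(S) = 0` (pair `x` with `x ⊕ e_i`, `i ∈ S \\ J`). -/
theorem cubeFourierCoeff_eq_zero_of_dependsOn {F : (Fin n → Bool) → ℝ} {J S : Finset (Fin n)}
    (hF : DependsOn F (↑J : Set (Fin n))) (hS : ¬ S ⊆ J) :
    cubeFourierCoeff F S = 0 := by
  obtain ⟨i, hiS, hiJ⟩ := Finset.not_subset.1 hS
  -- the flip of coordinate `i` is an involution of the cube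
  set φ : (Fin n → Bool) → (Fin n → Bool) := fun x => Function.update x i (!x i) with hφ
  have hφφ : Function.Involutive φ := by
    intro x
    funext j
    by_cases hj : j = i
    · subst hj; simp [hφ]
    · simp [hφ, Function.update_of_ne hj]
  have hFφ : ∀ x, F (φ x) = F x := by
    intro x
    refine hF fun j hj => ?_
    have hji : j ≠ i := fun h => hiJ (h ▸ Finset.mem_coe.1 hj)
    simp [hφ, Function.update_of_ne hji]
  have hsum : ∑ x, F x * walsh S x = -∑ x, F x * walsh S x := by
    calc ∑ x, F x * walsh S x = ∑ x, F (φ x) * walsh S (φ x) :=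
          (Fintype.sum_bijective φ hφφ.bijective _ _ fun x => rfl).symm
      _ = ∑ x, -(F x * walsh S x) := by
          refine Finset.sum_congr rfl fun x _ => ?_
          rw [hFφ x, hφ, walsh_update_not hiS]
          ring
      _ = -∑ x, F x * walsh S x := Finset.sum_neg_distrib ..
  have hzero : ∑ x, F x * walsh S x = 0 := by linarith
  rw [cubeFourierCoeff, hzero, zero_div]

/-- **A junta on `J` has no Fourier weight above level `|J|`.** -/
theorem tailWeight_junta_eq_zero {F : (Fin n → Bool) → ℝ} {J : Finset (Fin n)}
    (hF : DependsOn F (↑J : Set (Fin n))) : tailWeight F (J.card + 1) = 0 := by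
  refine Finset.sum_eq_zero fun S hS => ?_
  simp only [Finset.mem_filter, Finset.mem_univ, true_and] at hS
  have hSJ : ¬ S ⊆ J := fun h => by have := Finset.card_le_card h; omega
  rw [cubeFourierCoeff_eq_zero_of_dependsOn hF hSJ]
  ring

end Junta

open Junta in
/-- **`λ` is orthogonal to every function of at most `n^α` binary digits** (unconditional): there is
`α > 0` such that for every `ε > 0`, for all sufficiently large `n`, every Boolean function `F` of the
`n` digits that depends only on a set `J` of at most `n^α` digit positions satisfies
`|Σ_{N<2ⁿ} λ(N) · sgn F(bits N)| ≤ ε · 2ⁿ` — uniformly in `J` and in `F`. -/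
theorem liouville_orthogonal_junta : ∃ α : ℝ, 0 < α ∧ ∀ ε : ℝ, 0 < ε → ∀ᶠ n : ℕ in atTop,
    ∀ (F : (Fin n → Bool) → Bool) (J : Finset (Fin n)), (J.card : ℝ) ≤ (n : ℝ) ^ α →
      DependsOn F (↑J : Set (Fin n)) →
        |∑ N ∈ Finset.range (2 ^ n), ((ArithmeticFunction.liouville N : ℤ) : ℝ) *
            sgn (F (fun i : Fin n => Nat.testBit N i))| ≤ ε * (2 : ℝ) ^ n := by
  obtain ⟨c, hc, hB⟩ := bourgain_liouville_walsh_holds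
  set R : ℕ := ⌈(3 : ℝ) / c⌉₊ with hRdef
  have hR1 : 1 ≤ R := by
    have : (0 : ℝ) < 3 / c := by positivity
    exact Nat.one_le_iff_ne_zero.mpr (Nat.pos_iff_ne_zero.mp (Nat.ceil_pos.mpr this))
  have hRc : 3 ≤ (R : ℝ) * c := by
    have h1 : (3 : ℝ) / c ≤ R := Nat.le_ceil _
    have := mul_le_mul_of_nonneg_right h1 hc.le
    rwa [div_mul_cancel₀ _ hc.ne'] at this
  have hRpos : (0 : ℝ) < R := by exact_mod_cast (show 0 < R by omega)
  refine ⟨1 / R, by positivity, fun ε hε => ?_⟩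
  filter_upwards [liouville_orthogonal_of_tailWeight_level hc hB hR1 hRc ε hε] with n hn F J hJ hF
  refine hn F ?_
  -- `|J| ≤ ⌊n^{1/R}⌋₊`, so the tail above level `⌊n^{1/R}⌋₊ + 1` vanishes
  have hJk : J.card ≤ ⌊((n : ℝ)) ^ ((1 : ℝ) / R)⌋₊ := Nat.le_floor hJ
  have hdep : DependsOn (fun x : Fin n → Bool => sgn (F x)) (↑J : Set (Fin n)) :=
    fun x y hxy => by simp only [hF hxy]
  have h0 := tailWeight_junta_eq_zero hdep
  calc tailWeight (fun x : Fin n → Bool => sgn (F x)) (⌊((n : ℝ)) ^ ((1 : ℝ) / R)⌋₊ + 1)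
      ≤ tailWeight (fun x : Fin n → Bool => sgn (F x)) (J.card + 1) :=
        tailWeight_antitone _ (by omega)
    _ = 0 := h0
    _ ≤ (ε / 3) ^ 2 := by positivity

/-- **Registered stub `stub_junta`**: verbatim `liouville_orthogonal_junta`. -/
theorem stub_junta : ∃ α : ℝ, 0 < α ∧ ∀ ε : ℝ, 0 < ε → ∀ᶠ n : ℕ in atTop, ∀ (F : (Fin n → Bool) → Bool) (J : Finset (Fin n)), (J.card : ℝ) ≤ (n : ℝ) ^ α → DependsOn F (↑J : Set (Fin n)) → |∑ N ∈ Finset.range (2 ^ n), ((ArithmeticFunction.liouville N : ℤ) : ℝ) * sgn (F (fun i : Fin n => Nat.testBit N i))| ≤ ε * (2 : ℝ) ^ n :=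
  liouville_orthogonal_junta

end Summit.QuantumAdvantage.QuantumAdvantage.Theorems.LiouvilleOrthogonalTC0
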